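import Summits.Ventures.QEDPrecision.Diagrams.NoLoopVertexGraphs

/-!
Venture QEDPrecision / cell `pub-qed`, unit `pub-qed-diag-2` (DIAG-2, gen 6, 2026-08-20). HONEST FRAMING: independent recomputation;
certified where stated, statistical where stated; no new-physics claim.  NEW WORK of the cell (a kernel-checked census), not a
published result; nothing here is cited as a fact anywhere; printed comparators are named only in this comment.
Staged copy: HOME/lean/diag2/SetVGapFamilies.lean (HOME = run/shared/lean/pub/pub-qed/; declarations byte-identical).

# Self-energy graphs without lepton loops that are FREE OF SELF-ENERGY SUBDIAGRAMS, and the vertex graphs of their Ward–Takahashi families (orders e² … e¹⁰)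

Model = the one of `NoLoopVertexGraphs` (same definitions, imported): a graph without lepton loops is one open lepton path on the
points `0 … N-1` with a photon matching `M`; self-energy graphs have `N = 2n` and a perfect matching, vertex graphs `N = 2n + 1` and one
unmatched point (the external vertex); one-particle irreducibility = every gap bridged; undirected graphs = canonical representatives
under the mirror `i ↦ N-1-i`, symmetric ones counted too.

A SELF-ENERGY SUBDIAGRAM of such a graph is a run of consecutive points `i … j`, `i < j`, other than the whole line, that is closed under
the matching (every photon has both ends inside or both outside).  For a vertex graph the same predicate says that the self-energy graph
obtained by deleting the external vertex has a self-energy subdiagram (a closed run containing the unmatched point corresponds to a closed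
run of the deleted word, and the external vertex is never at an end of an irreducible vertex graph), i.e. that the graph's
Ward–Takahashi family — the set of vertex graphs obtained from one self-energy graph by inserting the external vertex into each lepton
line — comes from a self-energy graph WITH a self-energy subdiagram.

Why the cell wants these numbers (HOME/pub-qed-diag-2/GAP-EQUATIONS.md §6.4, §6.6): at order 10 the 389 undirected self-energy graphs are
AHKN's Set V representatives X001–X389 and the per-diagram "gap equations" between the AHKN and Volkov finite amplitudes were generated by
the cell for exactly the self-energy-subdiagram-free ones; their number, 135, the number of vertex graphs in their families, 1127 of
Volkov's 3213, and the sum of their time-reversal factors, 248, are the sizes quoted there (and the 135 equations are the ones on which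
the cell's two independent implementations were compared symbol by symbol).

Certified here (kernel `decide`, no `native_decide`, no axioms beyond the standard ones), for n = 1 … 5 photons (orders e² … e¹⁰):
* self-energy graphs free of self-energy subdiagrams: directed 1, 1, 4, 27, 248 · undirected 1, 1, 3, 17, 135 · mirror-symmetric 1, 1, 2, 7, 22
  (of the directed 1, 2, 10, 74, 706 / undirected 1, 2, 8, 47, 389 certified in `NoLoopVertexGraphs`);
* vertex graphs whose family is free of self-energy subdiagrams: directed 1, 3, 20, 189, 2232 · undirected 1, 2, 11, 98, 1127;
* consistency on the numerals: Burnside `2 · undirected = directed + symmetric` for the self-energy rows, and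
  `directed vertex = (2n - 1) · directed self-energy` (the `2n - 1` insertion places), n = 1 … 5.
-/

namespace Summit.Ventures.QEDPrecision.Diagrams

/-- The run of consecutive points `i … j` is closed under the matching `M`: every photon has both ends inside it or both outside. -/
def runClosed (M : List (ℕ × ℕ)) (i j : ℕ) : Bool :=
  M.all (fun ab => (decide (i ≤ ab.1) && decide (ab.1 ≤ j)) == (decide (i ≤ ab.2) && decide (ab.2 ≤ j)))

/-- The graph on the points `0 … N-1` with matching `M` has a self-energy subdiagram: a closed run `i … j`, `i < j`, other than the whole line. -/
def hasSelfEnergySub (N : ℕ) (M : List (ℕ × ℕ)) : Bool :=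
  (List.range N).any (fun i => (List.range N).any (fun j =>
    decide (i < j) && !(decide (i = 0) && decide (j = N - 1)) && runClosed M i j))

/-- Free of self-energy subdiagrams. -/
def seFree (N : ℕ) (M : List (ℕ × ℕ)) : Bool := !(hasSelfEnergySub N M)

/-- Directed self-energy graphs with `n` photons that are free of self-energy subdiagrams. -/
def seFreeSelfEnergyDirected (n : ℕ) : ℕ := ((selfEnergyGraphs n).filter (seFree (2 * n))).length

/-- Undirected (canonical under the mirror) self-energy graphs with `n` photons free of self-energy subdiagrams. -/
def seFreeSelfEnergyUndirected (n : ℕ) : ℕ :=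
  (((selfEnergyGraphs n).filter (isCanonical (2 * n))).filter (seFree (2 * n))).length

/-- Mirror-symmetric self-energy graphs with `n` photons free of self-energy subdiagrams. -/
def seFreeSelfEnergySymmetric (n : ℕ) : ℕ :=
  (((selfEnergyGraphs n).filter (isSymmetric (2 * n))).filter (seFree (2 * n))).length

/-- Directed vertex graphs with `n` internal photons whose Ward–Takahashi family is free of self-energy subdiagrams. -/
def seFreeVertexDirected (n : ℕ) : ℕ := ((vertexGraphs n).filter (seFree (2 * n + 1))).length

/-- Undirected vertex graphs with `n` internal photons whose Ward–Takahashi family is free of self-energy subdiagrams. -/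
def seFreeVertexUndirected (n : ℕ) : ℕ :=
  (((vertexGraphs n).filter (isCanonical (2 * n + 1))).filter (seFree (2 * n + 1))).length

/-- Orders e², e⁴: the lists themselves.  At order 4 the crossed graph `abab` = `[(0,2),(1,3)]` is free, the rainbow `abba` = `[(0,3),(1,2)]`
is not (the run `1 … 2` is closed). -/
theorem seFree_order2_4_explicit :
    (selfEnergyGraphs 1).filter (seFree 2) = [[(0, 1)]] ∧
    (selfEnergyGraphs 2).filter (seFree 4) = [[(0, 2), (1, 3)]] ∧
    (vertexGraphs 2).filter (seFree 5) = [[(0, 3), (2, 4)], [(0, 3), (1, 4)], [(0, 2), (1, 4)]] := by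
  decide +kernel

/-- Self-energy graphs free of self-energy subdiagrams, n = 1 … 4 photons: directed, undirected, symmetric. -/
theorem seFreeSelfEnergy_values_upto8 :
    (List.range 4).map (fun k => (seFreeSelfEnergyDirected (k + 1), seFreeSelfEnergyUndirected (k + 1), seFreeSelfEnergySymmetric (k + 1)))
      = [(1, 1, 1), (1, 1, 1), (4, 3, 2), (27, 17, 7)] := by
  decide +kernel

/-- Order e¹⁰ (n = 5): 248 directed / 135 undirected / 22 symmetric of the 706 / 389 / 72 self-energy graphs are free of self-energy subdiagrams. -/
theorem seFreeSelfEnergy_values_order10 :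
    seFreeSelfEnergyDirected 5 = 248 ∧ seFreeSelfEnergyUndirected 5 = 135 ∧ seFreeSelfEnergySymmetric 5 = 22 := by
  refine ⟨?_, ?_, ?_⟩ <;> decide +kernel

/-- Vertex graphs whose family is free of self-energy subdiagrams, n = 1 … 4: directed, undirected. -/
theorem seFreeVertex_values_upto8 :
    (List.range 4).map (fun k => (seFreeVertexDirected (k + 1), seFreeVertexUndirected (k + 1)))
      = [(1, 1), (3, 2), (20, 11), (189, 98)] := by
  decide +kernel

set_option maxHeartbeats 10000000 in
/-- Order e¹⁰ (n = 5): 2232 directed vertex graphs (of 6354) lie in families free of self-energy subdiagrams (kernel `decide`; the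
heartbeat ceiling is raised for the 10 395-matching enumeration, nothing else changes). -/
theorem seFreeVertexDirected_order10 : seFreeVertexDirected 5 = 2232 := by
  decide +kernel

set_option maxHeartbeats 10000000 in
/-- Order e¹⁰ (n = 5): 1127 undirected vertex graphs (of Volkov's 3213) lie in families free of self-energy subdiagrams. -/
theorem seFreeVertexUndirected_order10 : seFreeVertexUndirected 5 = 1127 := by
  decide +kernel

/-- Consistency of the certified numerals: Burnside for the self-energy rows and `directed vertex = (2n-1) · directed self-energy`
(the insertion places of the external vertex), n = 1 … 5. -/
theorem seFree_consistency :
    (2 * 1 = 1 + 1 ∧ 2 * 1 = 1 + 1 ∧ 2 * 3 = 4 + 2 ∧ 2 * 17 = 27 + 7 ∧ 2 * 135 = 248 + 22) ∧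
    (1 = 1 * 1 ∧ 3 = 3 * 1 ∧ 20 = 5 * 4 ∧ 189 = 7 * 27 ∧ 2232 = 9 * 248) := by
  decide

end Summit.Ventures.QEDPrecision.Diagrams
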